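import Summits.AnomalousDissipation.AnomalousDissipation.Theorems.LaminarNeverLoud.Negative.Isolation
import Literature.Barriers.AnomalousDissipation.CodimensionOneRigidity
import Literature.Analysis.FunctionSpaces.TorusFourierCalculus

/-!
# Line `Sketch` of the crux `MirrorVariety.LaminarNeverLoud` (stmt-AnomalousDissipation-2988): the glue

Stub `stub_glue` of the lead's skeleton of the line `Sketch` (namespace
`…Theorems.LaminarNeverLoud.LineSketch`).  The line reduces the crux (in its unfolded form
`Negative.laminarNeverLoud_iff`: every smooth solenoidal mean-free force has, for all budgets `(E, ε)`, a
positive admissible laminar threshold) to two propositions: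

* the ENGINE `QuietOfLayeredLimits` — families of bounded-energy steady Galerkin states (any resolutions,
  `ν_j → 0⁺`) converging in `L³(T³)` to an essentially bounded field of bounded variation are quiet
  (`ν_j ‖∇U_j‖² → 0`);
* the BET `LaminarLayeredCompactness` — bounded-energy LAMINAR steady Galerkin families with `ν_j → 0⁺`
  have an `L³`-convergent subsequence with such a limit.

This file is the bookkeeping `ENGINE → BET → crux`: by contradiction, if no positive admissible threshold
exists, choice along `ν₀ = 1/(j+1)` produces loud bounded laminar steady Galerkin states `(c_j, ν_j)` with
`ν_j → 0`; the BET extracts an `L³`-convergent subsequence, the ENGINE says it is quiet, but by the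
Parseval dictionary (`∫‖U‖² = energy c`, `ν·‖∇U‖² = dissipation ν c`, tested Galerkin equations from
`sum_re_inner_galerkinField_test`) each term of the quiet sequence is `≥ ε`.
-/

noncomputable section

-- `Summit.<Summit>.<Problem>`: single-conjunct summit, duplicate deliberate (CONVENTIONS §2).
set_option linter.dupNamespace false

namespace Summit.AnomalousDissipation.AnomalousDissipation.Theorems.LaminarNeverLoud.LineSketch

open MeasureTheory Set Filter Topology UnitAddTorus
open scoped InnerProductSpace ENNReal
open Literature.Analysis.FluidPDE Literature.Analysis.FluidPDE.Torus
open Literature.Analysis.FunctionSpaces Literature.Analysis.FunctionSpaces.Torus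
open Literature.Barriers.AnomalousDissipation (torusTotalVariation)
open Summit.AnomalousDissipation.AnomalousDissipation.Theorems.LaminarNeverLoud.Negative

/-- Complex Fourier coefficient values. -/
local notation "ℂ³" => EuclideanSpace ℂ (Fin 3)
/-- Real velocity values. -/
local notation "ℝ³" => EuclideanSpace ℝ (Fin 3)
/-- The flat unit torus `T³`. -/
local notation "𝕋³" => UnitAddTorus (Fin 3)

/-! ## §0 Vocabulary of the line (its §2) -/

/-- A Fourier–Galerkin steady state at resolution `N`, viscosity `ν`, force `f`, in the tested form of the
route's target `GalerkinSteadyZerothLaw`. [folklore] -/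
def IsGalerkinSteadyField (N : ℕ) (ν : ℝ) (f U : 𝕋³ → ℝ³) : Prop :=
  IsSmooth U ∧ IsDivFree U ∧ HasZeroMean U ∧
    (∀ k ∉ (freqBall N).erase (0 : Fin 3 → ℤ), mFourierCoeff (EuclideanSpace.complexify ∘ U) k = 0) ∧
    ∀ a : 𝕋³ → ℝ³, IsSmooth a → IsDivFree a →
      (∀ k ∉ (freqBall N).erase (0 : Fin 3 → ℤ), mFourierCoeff (EuclideanSpace.complexify ∘ a) k = 0) →
        ∫ x, (inner ℝ (U x) (convect U a x) + ν * inner ℝ (U x) (laplacian a x) + inner ℝ (f x) (a x)) = 0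

/-- ENGINE of the line: families of bounded-energy steady Galerkin states (any resolutions) converging in
`L³(T³)` to an essentially bounded field of bounded variation are quiet.  (Statement of the registered stub
`stub_quietOfLayeredLimits` of stmt-AnomalousDissipation-2988: an obligation of the line, not a published fact.) -/
def QuietOfLayeredLimits : Prop :=
  ∀ f : 𝕋³ → ℝ³, IsSmooth f → IsDivFree f → HasZeroMean f →
    ∀ (E : ℝ) (Nj : ℕ → ℕ) (ν : ℕ → ℝ) (U : ℕ → 𝕋³ → ℝ³) (u : 𝕋³ → ℝ³),
      (∀ j, 0 < ν j) → Tendsto ν atTop (𝓝 0) →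
      (∀ j, IsGalerkinSteadyField (Nj j) (ν j) f (U j) ∧ ∫ x, ‖U j x‖ ^ 2 ≤ E) →
      Tendsto (fun j => ∫ x, ‖U j x - u x‖ ^ 3) atTop (𝓝 0) →
      (∃ M : ℝ, ∀ᵐ x, ‖u x‖ ≤ M) → torusTotalVariation u < ∞ →
        Tendsto (fun j => ν j * gradNormSq (U j)) atTop (𝓝 0)

/-- BET of the line: bounded-energy LAMINAR steady Galerkin families with `ν_j → 0⁺` have an `L³`-convergent
subsequence with an essentially bounded `BV` limit.  (Statement of the registered stub
`stub_laminarLayeredCompactness` of stmt-AnomalousDissipation-2988: an obligation of the line, not a published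
fact.) -/
def LaminarLayeredCompactness : Prop :=
  ∀ f : 𝕋³ → ℝ³, IsSmooth f → IsDivFree f → HasZeroMean f →
    ∀ (E : ℝ) (Nj : ℕ → ℕ) (ν : ℕ → ℝ) (U : ℕ → 𝕋³ → ℝ³),
      (∀ j, 0 < ν j) → Tendsto ν atTop (𝓝 0) →
      (∀ j, ∃ c : ↥(modes (Fin 3) (Nj j)) → ℂ³,
        (c, ν j) ∈ steadySet (modes (Fin 3) (Nj j)) (forceCoeff (modes (Fin 3) (Nj j)) f) ∧
        (c, ν j) ∈ laminarSet (steadySet (modes (Fin 3) (Nj j)) (forceCoeff (modes (Fin 3) (Nj j)) f)) ∧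
        energy c ≤ E ∧ U j = realTrigPoly (modes (Fin 3) (Nj j)) (coeffExt (modes (Fin 3) (Nj j)) c)) →
      ∃ (φ : ℕ → ℕ) (u : 𝕋³ → ℝ³), StrictMono φ ∧
        Tendsto (fun j => ∫ x, ‖U (φ j) x - u x‖ ^ 3) atTop (𝓝 0) ∧
        (∃ M : ℝ, ∀ᵐ x, ‖u x‖ ≤ M) ∧ torusTotalVariation u < ∞

/-! ## §1 The Parseval dictionary between coefficient states and their fields -/

/-- **Tested Galerkin equations** of a steady Galerkin state: if `(c, ν)` lies on the steady variety
`steadySet (modes N) (forceCoeff (modes N) f)` of a smooth force `f`, then the field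
`U = realTrigPoly (modes N) c̄` is a smooth, divergence-free, mean-free trigonometric polynomial band-limited
to the punctured ball and `∫ (⟪U, (U·∇)a⟫ + ν⟪U, Δa⟫ + ⟪f, a⟫) = 0` for every smooth divergence-free `a`
band-limited to the punctured ball (the passage of `exists_steady_galerkin_approx`, Temam 1979 Ch. II
(1.25), from a zero of the Galerkin field to the tested form, via `sum_re_inner_galerkinField_test` and
Parseval for the force term). [folklore] -/
theorem isGalerkinSteadyField_of_mem_steadySet {f : 𝕋³ → ℝ³} (hf : IsSmooth f) {N : ℕ} {ν : ℝ}
    {c : ↥(modes (Fin 3) N) → ℂ³}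
    (h : (c, ν) ∈ steadySet (modes (Fin 3) N) (forceCoeff (modes (Fin 3) N) f)) :
    IsGalerkinSteadyField N ν f (realTrigPoly (modes (Fin 3) N) (coeffExt (modes (Fin 3) N) c)) := by
  have hS : ∀ k ∈ modes (Fin 3) N, -k ∈ modes (Fin 3) N := modes_symm (d := Fin 3) N
  have hS0 : (0 : Fin 3 → ℤ) ∉ modes (Fin 3) N := zero_not_mem_modes (d := Fin 3) N
  have hfi : Integrable f volume := (hf.memLp 2).integrable one_le_two
  have hgr : IsRealCoeff (forceCoeff (modes (Fin 3) N) f) := isRealCoeff_forceCoeff _ hfi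
  have hc : c ∈ galerkinSubspace (modes (Fin 3) N) := h.1
  have h0 : galerkinRHS (modes (Fin 3) N) ν (forceCoeff (modes (Fin 3) N) f) c = 0 := h.2
  have hCsymm : IsConjSymm (coeffExt (modes (Fin 3) N) c) := hc.1.isConjSymm_coeffExt hS
  have hCT : IsTransversal (modes (Fin 3) N) (coeffExt (modes (Fin 3) N) c) :=
    hc.2.isTransversal_coeffExt
  have hGg :
      realTrigPoly (modes (Fin 3) N) (coeffExt (modes (Fin 3) N) (forceCoeff (modes (Fin 3) N) f)) =
        realTrigPoly (modes (Fin 3) N) fun k => mFourierCoeff (EuclideanSpace.complexify ∘ f) k :=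
    realTrigPoly_coeffExt_restrict (S := modes (Fin 3) N)
      fun k => mFourierCoeff (EuclideanSpace.complexify ∘ f) k
  have hu : IsSmooth (realTrigPoly (modes (Fin 3) N) (coeffExt (modes (Fin 3) N) c)) :=
    isSmooth_realTrigPoly _ _
  refine ⟨hu, isDivFree_realTrigPoly hCT, hasZeroMean_realTrigPoly_of_zero_not_mem hS0 _,
    fun k hk => mFourierCoeff_realTrigPoly_eq_zero hS hCsymm hk, ?_⟩
  intro a ha hdiv hband
  have hid :=
    sum_re_inner_galerkinField_test ν hS (hgr.isConjSymm_coeffExt hS) hCsymm hCT ha hdiv hband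
  have hzero : ∑ k ∈ modes (Fin 3) N, (inner ℂ (galerkinField ν (modes (Fin 3) N)
      (coeffExt (modes (Fin 3) N) (forceCoeff (modes (Fin 3) N) f)) (coeffExt (modes (Fin 3) N) c) k)
      (mFourierCoeff (EuclideanSpace.complexify ∘ a) k)).re = 0 := by
    refine Finset.sum_eq_zero fun k hk => ?_
    have hk0 : galerkinField ν (modes (Fin 3) N)
        (coeffExt (modes (Fin 3) N) (forceCoeff (modes (Fin 3) N) f)) (coeffExt (modes (Fin 3) N) c) k = 0 := by
      have := congrFun h0 ⟨k, hk⟩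
      rwa [galerkinRHS_apply] at this
    rw [hk0, inner_zero_left, Complex.zero_re]
  rw [hzero, hGg] at hid
  -- split off the force term and rewrite it by Parseval
  have hGs :
      IsSmooth (realTrigPoly (modes (Fin 3) N) fun k => mFourierCoeff (EuclideanSpace.complexify ∘ f) k) :=
    isSmooth_realTrigPoly _ _
  have i1 : Integrable (fun x => ⟪realTrigPoly (modes (Fin 3) N) (coeffExt (modes (Fin 3) N) c) x,
      convect (realTrigPoly (modes (Fin 3) N) (coeffExt (modes (Fin 3) N) c)) a x⟫_ℝ +
      ν * ⟪realTrigPoly (modes (Fin 3) N) (coeffExt (modes (Fin 3) N) c) x, laplacian a x⟫_ℝ)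
      volume :=
    ((hu.continuous.inner (hu.convect ha).continuous).add
      ((hu.continuous.inner ha.laplacian.continuous).const_smul ν)).integrable_unitAddTorus
  have i2 : Integrable (fun x => ⟪realTrigPoly (modes (Fin 3) N)
      (fun k => mFourierCoeff (EuclideanSpace.complexify ∘ f) k) x, a x⟫_ℝ) volume :=
    (hGs.continuous.inner ha.continuous).integrable_unitAddTorus
  have i3 : Integrable (fun x => ⟪f x, a x⟫_ℝ) volume :=
    integrable_inner_of_continuous hfi ha.continuous
  have hforce := integral_inner_realTrigPoly_mFourierCoeff_eq hS (hf.memLp 2)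
    (ha.continuous.memLp_of_hasCompactSupport (HasCompactSupport.of_compactSpace _)) hband
  rw [integral_add i1 i2, hforce, ← integral_add i1 i3] at hid
  exact hid.symm

/-- **Energy dictionary**: `∫ ‖U‖² = energy c` for the field `U = realTrigPoly (modes N) c̄` of a real
coefficient vector `c` (finite Parseval). [folklore] -/
theorem integral_norm_sq_eq_energy {N : ℕ} {c : ↥(modes (Fin 3) N) → ℂ³} (hc : IsRealCoeff c) :
    ∫ x, ‖realTrigPoly (modes (Fin 3) N) (coeffExt (modes (Fin 3) N) c) x‖ ^ 2 = energy c := by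
  have hS : ∀ k ∈ modes (Fin 3) N, -k ∈ modes (Fin 3) N := modes_symm (d := Fin 3) N
  rw [integral_norm_sq_realTrigPoly hS (hc.isConjSymm_coeffExt hS),
    sum_coeffExt (fun _ v => ‖v‖ ^ 2) c]
  rfl

/-- **Dissipation dictionary**: `ν · ‖∇U‖² = dissipation ν c` for the field `U = realTrigPoly (modes N) c̄`
of a real coefficient vector `c` (pointwise gradient norm = spectral gradient norm on smooth fields,
`gradNormSq_eq_toReal_eGradNormSq_holds`, and the spectral norm of a trigonometric polynomial). [folklore] -/
theorem mul_gradNormSq_eq_dissipation {N : ℕ} (ν : ℝ) {c : ↥(modes (Fin 3) N) → ℂ³}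
    (hc : IsRealCoeff c) :
    ν * gradNormSq (realTrigPoly (modes (Fin 3) N) (coeffExt (modes (Fin 3) N) c)) = dissipation ν c := by
  have hS : ∀ k ∈ modes (Fin 3) N, -k ∈ modes (Fin 3) N := modes_symm (d := Fin 3) N
  rw [gradNormSq_eq_toReal_eGradNormSq_holds (isSmooth_realTrigPoly _ _),
    toReal_eGradNormSq_realTrigPoly hS (hc.isConjSymm_coeffExt hS),
    sum_coeffExt (fun k v => freqNormSq k * ‖v‖ ^ 2) c]
  rfl

/-- **No loud laminar sequences**: under the ENGINE and the BET, a smooth solenoidal mean-free force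
admits no sequence of laminar steady Galerkin states `(c_j, ν_j)` with `0 < ν_j → 0`, `energy c_j ≤ E`
and `ε ≤ dissipation ν_j c_j`, `ε > 0` (the BET extracts an `L³`-convergent subsequence with a bounded
`BV` limit, the ENGINE makes it quiet, the dissipation dictionary contradicts loudness). [folklore] -/
theorem not_loud_of_layered (hQ : QuietOfLayeredLimits) (hC : LaminarLayeredCompactness) {f : 𝕋³ → ℝ³}
    (hf : IsSmooth f) (hdiv : IsDivFree f) (hmean : HasZeroMean f) {E ε : ℝ} (hε : 0 < ε)
    (Nj : ℕ → ℕ) (c : ∀ j : ℕ, ↥(modes (Fin 3) (Nj j)) → ℂ³) (ν : ℕ → ℝ)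
    (hz : ∀ j, (c j, ν j) ∈ steadySet (modes (Fin 3) (Nj j)) (forceCoeff (modes (Fin 3) (Nj j)) f))
    (hlam : ∀ j, (c j, ν j) ∈
      laminarSet (steadySet (modes (Fin 3) (Nj j)) (forceCoeff (modes (Fin 3) (Nj j)) f)))
    (hpos : ∀ j, 0 < ν j) (hνt : Tendsto ν atTop (𝓝 0)) (hE : ∀ j, energy (c j) ≤ E)
    (hloud : ∀ j, ε ≤ dissipation (ν j) (c j)) : False := by
  have hreal : ∀ j, IsRealCoeff (c j) := fun j => (hz j).1.1
  -- the BET: an `L³`-convergent subsequence with a bounded `BV` limit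
  obtain ⟨φ, u, hφ, hL3, hM, hTV⟩ := hC f hf hdiv hmean E Nj ν
    (fun j => realTrigPoly (modes (Fin 3) (Nj j)) (coeffExt (modes (Fin 3) (Nj j)) (c j))) hpos hνt
    fun j => ⟨c j, hz j, hlam j, hE j, rfl⟩
  -- the ENGINE along the subsequence
  have hfam : ∀ j, IsGalerkinSteadyField (Nj (φ j)) (ν (φ j)) f
      (realTrigPoly (modes (Fin 3) (Nj (φ j))) (coeffExt (modes (Fin 3) (Nj (φ j))) (c (φ j)))) ∧
      ∫ x, ‖realTrigPoly (modes (Fin 3) (Nj (φ j)))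
        (coeffExt (modes (Fin 3) (Nj (φ j))) (c (φ j))) x‖ ^ 2 ≤ E :=
    fun j => ⟨isGalerkinSteadyField_of_mem_steadySet hf (hz (φ j)),
      (integral_norm_sq_eq_energy (hreal (φ j))).le.trans (hE (φ j))⟩
  have hquiet : Tendsto (fun j => ν (φ j) * gradNormSq
      (realTrigPoly (modes (Fin 3) (Nj (φ j))) (coeffExt (modes (Fin 3) (Nj (φ j))) (c (φ j)))))
      atTop (𝓝 0) :=
    hQ f hf hdiv hmean E (fun j => Nj (φ j)) (fun j => ν (φ j))
      (fun j => realTrigPoly (modes (Fin 3) (Nj (φ j))) (coeffExt (modes (Fin 3) (Nj (φ j))) (c (φ j)))) u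
      (fun j => hpos (φ j)) (hνt.comp hφ.tendsto_atTop) hfam hL3 hM hTV
  -- but every term of the quiet sequence is `dissipation ≥ ε`
  have hquiet' : Tendsto (fun j => dissipation (ν (φ j)) (c (φ j))) atTop (𝓝 0) :=
    hquiet.congr fun j => mul_gradNormSq_eq_dissipation (ν (φ j)) (hreal (φ j))
  obtain ⟨j, hj⟩ := (hquiet'.eventually (gt_mem_nhds hε)).exists
  exact absurd (hloud (φ j)) (not_le.2 hj)

/-! ## §2 The glue -/

/-- **Glue of the line `Sketch`**: the ENGINE `QuietOfLayeredLimits` and the BET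
`LaminarLayeredCompactness` imply the crux in its unfolded form (`Negative.laminarNeverLoud_iff`): every
smooth solenoidal mean-free force has, for all budgets `(E, ε)`, `ε > 0`, a positive admissible laminar
threshold.  By contradiction from the kill shape: choice along `ν₀ = 1/(j+1)` gives loud bounded laminar
steady Galerkin states with `ν_j → 0`; the BET gives an `L³`-convergent subsequence with a bounded `BV`
limit; the ENGINE makes it quiet, `ν_j‖∇U_j‖² → 0`; but `ν_j‖∇U_j‖² = dissipation ν_j c_j ≥ ε` by the
Parseval dictionary. [folklore] -/
theorem stub_glue : QuietOfLayeredLimits → LaminarLayeredCompactness →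
    ∀ f : 𝕋³ → ℝ³, IsSmooth f → IsDivFree f → HasZeroMean f →
      ∀ E ε : ℝ, 0 < ε → ∃ ν₀ ∈ admissibleSet f E ε, 0 < ν₀ := by
  intro hQ hC f hf hdiv hmean E ε hε
  by_contra hno
  -- below every threshold `1/(j+1)` there is a loud bounded laminar steady Galerkin state
  have hex : ∀ j : ℕ, ∃ N : ℕ, ∃ c : ↥(modes (Fin 3) N) → ℂ³, ∃ ν : ℝ,
      (c, ν) ∈ steadySet (modes (Fin 3) N) (forceCoeff (modes (Fin 3) N) f) ∧
      (c, ν) ∈ laminarSet (steadySet (modes (Fin 3) N) (forceCoeff (modes (Fin 3) N) f)) ∧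
        0 < ν ∧ ν < 1 / ((j : ℝ) + 1) ∧ energy c ≤ E ∧ ε ≤ dissipation ν c := by
    intro j
    by_contra hN
    apply hno
    refine ⟨1 / ((j : ℝ) + 1), ?_, by positivity⟩
    rintro N ⟨c, ν⟩ hz hlam hpos hlt hE
    by_contra hd
    exact hN ⟨N, c, ν, hz, hlam, hpos, hlt, hE, not_lt.1 hd⟩
  choose Nj c ν hz hlam hpos hlt hE hloud using hex
  exact not_loud_of_layered hQ hC hf hdiv hmean hε Nj c ν hz hlam hpos
    (squeeze_zero (fun j => (hpos j).le) (fun j => (hlt j).le) tendsto_one_div_add_atTop_nhds_zero_nat)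
    hE hloud

end Summit.AnomalousDissipation.AnomalousDissipation.Theorems.LaminarNeverLoud.LineSketch

end

-- buildfix 2026-08-20 (ops-buildfix-1 gen 7): enqueue-only re-land — rebuild after B-35 (StokesArc, p233893) healed this module's import closure; no declaration changed.
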